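import Summits.QuantumFields.BalabanUV.T4Continuum.Support.NE7SliceLetterGaugeObstruction
import Summits.QuantumFields.BalabanUV.T4Continuum.Support.NE7CriticalTensionLetter
import Summits.QuantumFields.BalabanUV.T4Continuum.Support.SkeletonLattice
import HarnessLib

/-!
# NE7HessGaugeDirLeftGeneral — THE FIRST-SLOT GAUGE HESSIAN FOR EVERY PERIODIC GENERATOR: for `P ≥ 2`, every `P`-periodic site field `ξ` is the sum over one period box of its
# PERIODISED SINGLE-SITE BUMPS (each sparse), and `hess`, `gaugeDir`, `dAction` are additive in the relevant slot, so F127's sparse formula extends by linearity: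
# `hess V (gaugeDir V ξ) Y F = dAction V (Yξ⁺ − ξ⁺Y) F` for ALL `P`-periodic `ξ` — hence the slice functional of ANY residual gauge mode is a first variation in a commutator
# direction: zero at a globally critical background, `≤ a·Σ_p‖curl_V K(p)‖` in general (file 63 of the curved (APE))

Cell `pub-balaban`, rung (B)+1 sub-cell t4, lineage `b2b-balaban-t4-ne7-p1` (CRUX PROVER NE7 #1 = OWNER of row NE7), generation 80; memo
`t4/b2b-balaban-t4-ne7-p1-g80/SLICE-LETTER-OBSTRUCTION.md` §3 (iv).  File F133, over F127 `NE7HessGaugeDirLeft.hess_gaugeDir_left_of_sparse`, F128's bump lemmas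
(`NE7SliceLetterGaugeObstruction.bump_sparse`), `NE7CriticalTensionLetter.dvd_iff_eq_of_mem_periodBox`, `SkeletonLattice.cmod`, `NE3EnergyHessBilin.hess_add_left`,
`NE7ExactCurrent.dAction_add`, `NE7OneStepLetters.abs_dAction_le_radius_mul`.
WHY.  The repaired slice-solver letter (memo §3) must price the GAUGE CONTENT `gaugeDir W ξ` of the consumer's tangent field `Z′ − A_N`; its slice functional is needed for a general
(non-sparse) generator `ξ` (road (B): `ξ ≈ −σ̃`, the block-constant or tent extension of the gauge's corner values).  F127 proved the formula for sparse generators by identifying the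
bondwise variation with the gauge orbit; a general generator is not sparse, but it is a finite sum of sparse ones over one period box, and both sides of the formula are additive.
WHAT ([folklore]; 0 def, 0 sorry).  §1 additivity over finite sums: `gaugeDir_sum`, `hess_sum_left`, `dAction_sum`; §2 the bump decomposition `eq_sum_bumps` (`P ≥ 1`, `ξ` `P`-periodic:
`ξ = Σ_{x₀ ∈ periodBox P} bump_{x₀}(ξ x₀)`) and `commDir_sum_bumps`; §3 **`hess_gaugeDir_left`** (every `P`-periodic `ξ`, `P ≥ 2`, every `V`, `Y`, `F`:
`hess V (gaugeDir V ξ) Y F = dAction V (Yξ⁺ − ξ⁺Y) F`), **`hess_gaugeDir_left_eq_zero_of_critical'`** (globally critical `V`, skew periodic `ξ`, `Y` ⟹ `= 0`),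
**`abs_hess_gaugeDir_left_le'`** (`≤ a·Σ_{p∈F}‖curl_V K(p)‖`, `SmallField V a`).
HONEST FRAMING (page 1): exact matrix calculus + finite-sum bookkeeping at one configuration; nothing of Bałaban's asserted; (APE) NOT proved; NOT ONE-STEP, NOT NE7; spine 0∕9; finite T⁴
rung (B)+1 — NOT infinite volume, NOT mass gap, NOT `BetaPertH`, NOT Clay.  Continuum YM on T⁴ ⇐ BetaPertH ∧ nine spine estimates (0/9 proved); BetaPertH ⇐ (D1) ∧ (D4) ∧ CAP+tail;
G-an2-4 gates asym, D1 and NE2/3/4.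
-/

set_option autoImplicit false

open scoped BigOperators Matrix.Norms.L2Operator
open NormedSpace Finset

namespace Summit.QuantumFields.BalabanUV.T4Continuum.NE7HessGaugeDirLeftGeneral

open Literature.MathematicalPhysics.QuantumFieldTheory.Balaban1983to89
open B7Prop1Explicit B7Prop2Explicit UnitaryModel
open T4AveragingDeficitWall hiding Site Plane Plaq Bond
open T4AveragingDeficitWallBoundary (IsPeriodicCfg periodBox mem_periodBox)
open AveragingDeficitPeriodicCounting (IsPeriodicDir)
open MinimalActionLevels (perWin)
open BlockAveragePushDirGauge (gaugeDir)
open NE3HessForm (hess dAction)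
open NE3EnergyHessBilin (hess_add_left hess_smul_left)
open NE7ExactCurrent (dAction_add dAction_smul)
open NE7OneStepLetters (abs_dAction_le_radius_mul)
open NE7HessGaugeDirLeft (hess_gaugeDir_left_of_sparse isSkewDir_commDir)
open NE7SliceLetterGaugeObstruction (bump_sparse)
open NE7CriticalTensionLetter (dvd_iff_eq_of_mem_periodBox)
open SkeletonLattice (cmod cdiv smul_cdiv_add_cmod cmod_nonneg cmod_lt)
open AveragingDeficitTorusChart (periodic_smul_vec)

noncomputable section

variable {d : ℕ} {n : Type*} [Fintype n] [DecidableEq n]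

/-! ## §1 Additivity over finite sums -/

/-- `gaugeDir` is additive over finite sums of generators. [folklore] -/
theorem gaugeDir_sum {ι : Type*} (s : Finset ι) (V : Site d → Fin d → (Matrix n n ℂ)ˣ) (f : ι → Site d → Matrix n n ℂ) :
    gaugeDir V (fun y => ∑ i ∈ s, f i y) = fun y κ => ∑ i ∈ s, gaugeDir V (f i) y κ := by
  funext y κ
  simp only [gaugeDir, Ad, Finset.mul_sum, Finset.sum_mul, Finset.sum_sub_distrib]

/-- `hess` is additive over finite sums in the first slot. [folklore] -/
theorem hess_sum_left {ι : Type*} (s : Finset ι) (V : Site d → Fin d → (Matrix n n ℂ)ˣ) (X : ι → Site d → Fin d → Matrix n n ℂ)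
    (Y : Site d → Fin d → Matrix n n ℂ) (F : Finset (T4AveragingDeficitWall.Plaq d)) :
    hess V (fun y κ => ∑ i ∈ s, X i y κ) Y F = ∑ i ∈ s, hess V (X i) Y F := by
  classical
  induction s using Finset.induction_on with
  | empty =>
      have h0 : hess V (fun (_ : Site d) (_ : Fin d) => (0 : Matrix n n ℂ)) Y F = 0 := by
        have h := hess_smul_left V F 0 (fun (_ : Site d) (_ : Fin d) => (0 : Matrix n n ℂ)) Y
        simp only [zero_mul] at h
        have hz : ((0 : ℝ) • fun (_ : Site d) (_ : Fin d) => (0 : Matrix n n ℂ)) = fun (_ : Site d) (_ : Fin d) => (0 : Matrix n n ℂ) := by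
          funext y κ; simp
        rwa [hz] at h
      simpa using h0
  | insert i s hi ih =>
      have hsplit : (fun y κ => ∑ j ∈ insert i s, X j y κ) = X i + fun y κ => ∑ j ∈ s, X j y κ := by
        funext y κ; rw [Finset.sum_insert hi]; rfl
      rw [hsplit, hess_add_left, ih, Finset.sum_insert hi]

/-- `dAction` is additive over finite sums of directions. [folklore] -/
theorem dAction_sum {ι : Type*} (s : Finset ι) (V : Site d → Fin d → (Matrix n n ℂ)ˣ) (X : ι → Site d → Fin d → Matrix n n ℂ)
    (F : Finset (T4AveragingDeficitWall.Plaq d)) :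
    dAction V (fun y κ => ∑ i ∈ s, X i y κ) F = ∑ i ∈ s, dAction V (X i) F := by
  classical
  induction s using Finset.induction_on with
  | empty =>
      have h0 : dAction V (fun (_ : Site d) (_ : Fin d) => (0 : Matrix n n ℂ)) F = 0 := by
        have h := dAction_smul V 0 (fun (_ : Site d) (_ : Fin d) => (0 : Matrix n n ℂ)) F
        simp only [zero_mul] at h
        have hz : ((0 : ℝ) • fun (_ : Site d) (_ : Fin d) => (0 : Matrix n n ℂ)) = fun (_ : Site d) (_ : Fin d) => (0 : Matrix n n ℂ) := by
          funext y κ; simp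
        rwa [hz] at h
      simpa using h0
  | insert i s hi ih =>
      have hsplit : (fun y κ => ∑ j ∈ insert i s, X j y κ) = X i + fun y κ => ∑ j ∈ s, X j y κ := by
        funext y κ; rw [Finset.sum_insert hi]; rfl
      rw [hsplit, dAction_add, ih, Finset.sum_insert hi]

/-! ## §2 The bump decomposition of a periodic site field -/

omit [Fintype n] [DecidableEq n] in
/-- The residue class of a site in the period box: for `x₀ ∈ periodBox P`, `(∀ i, P ∣ y i − x₀ i) ↔ x₀ = cmod P y`. [folklore] -/
theorem dvd_iff_eq_cmod {P : ℕ} (hP : 1 ≤ P) {x₀ : Site d} (hx₀ : x₀ ∈ periodBox (d := d) P) (y : Site d) :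
    (∀ i, (P : ℤ) ∣ y i - x₀ i) ↔ x₀ = cmod P y := by
  have hcm : cmod P y ∈ periodBox (d := d) P := (mem_periodBox).2 fun k => ⟨cmod_nonneg hP y k, cmod_lt hP y k⟩
  have hshift : ∀ i, ((P : ℤ) ∣ y i - x₀ i) ↔ ((P : ℤ) ∣ cmod P y i - x₀ i) := by
    intro i
    have hy : y i = (P : ℤ) * cdiv P y i + cmod P y i := by
      have h := congrFun (smul_cdiv_add_cmod P y) i
      simp only [Pi.add_apply, Pi.smul_apply, smul_eq_mul] at h
      exact h.symm
    rw [hy, show (P : ℤ) * cdiv P y i + cmod P y i - x₀ i = (cmod P y i - x₀ i) + (P : ℤ) * cdiv P y i by ring]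
    exact dvd_add_left (dvd_mul_right _ _)
  rw [forall_congr' hshift, dvd_iff_eq_of_mem_periodBox hx₀ hcm]
  exact ⟨fun h => h.symm, fun h => h.symm⟩

omit [Fintype n] [DecidableEq n] in
/-- **THE BUMP DECOMPOSITION**: a `P`-periodic site field is the sum over the period box of its periodised single-site bumps. [folklore] -/
theorem eq_sum_bumps {P : ℕ} (hP : 1 ≤ P) {ξ : Site d → Matrix n n ℂ} (hξP : ∀ (y : Site d) (i : Fin d), ξ (y + (P : ℤ) • e i) = ξ y) :
    ξ = fun y => ∑ x₀ ∈ periodBox (d := d) P, (if (∀ i : Fin d, (P : ℤ) ∣ y i - x₀ i) then ξ x₀ else 0) := by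
  classical
  funext y
  have hcm : cmod P y ∈ periodBox (d := d) P := (mem_periodBox).2 fun k => ⟨cmod_nonneg hP y k, cmod_lt hP y k⟩
  have hrw : ∀ x₀ ∈ periodBox (d := d) P, (if (∀ i : Fin d, (P : ℤ) ∣ y i - x₀ i) then ξ x₀ else 0) = if x₀ = cmod P y then ξ x₀ else 0 :=
    fun x₀ hx₀ => by simp only [dvd_iff_eq_cmod hP hx₀ y]
  rw [Finset.sum_congr rfl hrw, Finset.sum_ite_eq' (periodBox (d := d) P) (cmod P y) ξ, if_pos hcm]
  -- `ξ (cmod P y) = ξ y` by periodicity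
  have hy : y = cmod P y + (P : ℤ) • cdiv P y := by rw [add_comm, smul_cdiv_add_cmod]
  have h := periodic_smul_vec (f := ξ) (N := (P : ℤ)) hξP (cmod P y) (cdiv P y)
  rw [← hy] at h
  exact h

omit [DecidableEq n] in
/-- The commutator direction of the sum of the bumps is the commutator direction of `ξ`. [folklore] -/
theorem commDir_sum_bumps {P : ℕ} (hP : 1 ≤ P) {ξ : Site d → Matrix n n ℂ} (hξP : ∀ (y : Site d) (i : Fin d), ξ (y + (P : ℤ) • e i) = ξ y)
    (Y : Site d → Fin d → Matrix n n ℂ) :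
    (fun y κ => ∑ x₀ ∈ periodBox (d := d) P,
        (Y y κ * (if (∀ i : Fin d, (P : ℤ) ∣ (y + e κ) i - x₀ i) then ξ x₀ else 0) - (if (∀ i : Fin d, (P : ℤ) ∣ (y + e κ) i - x₀ i) then ξ x₀ else 0) * Y y κ))
      = fun y κ => Y y κ * ξ (y + e κ) - ξ (y + e κ) * Y y κ := by
  funext y κ
  have h := congrFun (eq_sum_bumps hP hξP) (y + e κ)
  rw [Finset.sum_sub_distrib, ← Finset.mul_sum, ← Finset.sum_mul, ← h]

/-! ## §3 The first-slot gauge Hessian for every periodic generator -/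

/-- **THE HESSIAN WITH A GAUGE DIRECTION IN THE FIRST SLOT, EVERY PERIODIC GENERATOR** (`P ≥ 2`, every background `V`, every `Y`, every window `F`):
`hess V (gaugeDir V ξ) Y F = dAction V K F`, `K(x,κ) = Y(x,κ)·ξ(x+e_κ) − ξ(x+e_κ)·Y(x,κ)`. [folklore] -/
theorem hess_gaugeDir_left {P : ℕ} (hP : 2 ≤ P) (V : Site d → Fin d → (Matrix n n ℂ)ˣ) {ξ : Site d → Matrix n n ℂ}
    (hξP : ∀ (y : Site d) (i : Fin d), ξ (y + (P : ℤ) • e i) = ξ y) (Y : Site d → Fin d → Matrix n n ℂ) (F : Finset (T4AveragingDeficitWall.Plaq d)) :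
    hess V (gaugeDir V ξ) Y F = dAction V (fun x κ => Y x κ * ξ (x + e κ) - ξ (x + e κ) * Y x κ) F := by
  classical
  have hP1 : 1 ≤ P := le_trans (by norm_num) hP
  -- decompose `ξ` into bumps and push the sum through `gaugeDir` and `hess`
  have hdec := eq_sum_bumps hP1 hξP
  have hgd : gaugeDir V ξ = fun y κ => ∑ x₀ ∈ periodBox (d := d) P,
      gaugeDir V (fun y' => if (∀ i : Fin d, (P : ℤ) ∣ y' i - x₀ i) then ξ x₀ else 0) y κ := by
    conv_lhs => rw [hdec]
    exact gaugeDir_sum _ V _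
  rw [hgd, hess_sum_left]
  -- each bump is sparse: F127
  have hterm : ∀ x₀ ∈ periodBox (d := d) P,
      hess V (gaugeDir V (fun y' => if (∀ i : Fin d, (P : ℤ) ∣ y' i - x₀ i) then ξ x₀ else 0)) Y F
        = dAction V (fun y κ => Y y κ * (if (∀ i : Fin d, (P : ℤ) ∣ (y + e κ) i - x₀ i) then ξ x₀ else 0)
            - (if (∀ i : Fin d, (P : ℤ) ∣ (y + e κ) i - x₀ i) then ξ x₀ else 0) * Y y κ) F :=
    fun x₀ _ => hess_gaugeDir_left_of_sparse V _ (bump_sparse (fun _ => rfl) hP) Y F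
  rw [Finset.sum_congr rfl hterm, ← dAction_sum]
  exact congrArg (fun K => dAction V K F) (commDir_sum_bumps hP1 hξP Y)

/-- **AT A GLOBALLY CRITICAL BACKGROUND THE SLICE FUNCTIONAL OF EVERY RESIDUAL GAUGE MODE VANISHES**: `dAction V Y′ (perWin d P) = 0` for all skew `P`-periodic `Y′` (`P ≥ 2`) ⟹ for
every skew `P`-periodic `ξ` and skew `P`-periodic `Y`, `hess V (gaugeDir V ξ) Y (perWin d P) = 0` (F127's statement without the sparseness hypothesis). [folklore] -/
theorem hess_gaugeDir_left_eq_zero_of_critical' (V : Site d → Fin d → (Matrix n n ℂ)ˣ) {P : ℕ} (hP : 2 ≤ P)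
    (hcrit : ∀ Y' : Site d → Fin d → Matrix n n ℂ, IsSkewDir Y' → IsPeriodicDir Y' (P : ℤ) → dAction V Y' (perWin d P) = 0)
    {ξ : Site d → Matrix n n ℂ} (hξs : ∀ x, ξ x ∈ skewAdjoint (Matrix n n ℂ)) (hξP : ∀ (x : Site d) (i : Fin d), ξ (x + (P : ℤ) • e i) = ξ x)
    {Y : Site d → Fin d → Matrix n n ℂ} (hY : IsSkewDir Y) (hYP : IsPeriodicDir Y (P : ℤ)) :
    hess V (gaugeDir V ξ) Y (perWin d P) = 0 := by
  rw [hess_gaugeDir_left hP V hξP Y]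
  exact hcrit _ (isSkewDir_commDir hξs hY) (NE7HessGaugeDirLeft.isPeriodicDir_commDir hξP hYP)

/-- **THE BOUND, EVERY PERIODIC GENERATOR**: unitary `V` with `SmallField V a`, skew `P`-periodic `ξ` (`P ≥ 2`), skew `Y` ⟹ `|hess V (gaugeDir V ξ) Y F| ≤ a·Σ_{p∈F} ‖curl_V K(p)‖`,
`K = Yξ⁺ − ξ⁺Y` (`‖K‖ ≤ 2‖ξ⁺‖‖Y‖`, F127 `norm_commDir_le`): the slice functional of the gauge content is as small as the background's curvature. [folklore] -/
theorem abs_hess_gaugeDir_left_le' [Nonempty n] {V : Site d → Fin d → (Matrix n n ℂ)ˣ} (hV : IsUnitaryCfg V) {a : ℝ} (hVa : SmallField V a)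
    {P : ℕ} (hP : 2 ≤ P) {ξ : Site d → Matrix n n ℂ} (hξs : ∀ x, ξ x ∈ skewAdjoint (Matrix n n ℂ))
    (hξP : ∀ (x : Site d) (i : Fin d), ξ (x + (P : ℤ) • e i) = ξ x)
    {Y : Site d → Fin d → Matrix n n ℂ} (hY : IsSkewDir Y) (F : Finset (T4AveragingDeficitWall.Plaq d)) :
    |hess V (gaugeDir V ξ) Y F| ≤ a * ∑ p ∈ F, ‖curl V (fun x κ => Y x κ * ξ (x + e κ) - ξ (x + e κ) * Y x κ) p‖ := by
  rw [hess_gaugeDir_left hP V hξP Y F]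
  exact abs_dAction_le_radius_mul hV (isSkewDir_commDir hξs hY) hVa F

end

end Summit.QuantumFields.BalabanUV.T4Continuum.NE7HessGaugeDirLeftGeneral
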